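import Summits.RiemannHypothesis.RiemannHypothesis.Theorems.SoninPolyTraceBound
import HarnessLib

/-!
# The twisted Sonin trace form of a polynomial section vector, V: the chunked kernel check and the lower bound `Blo ≤ B`

Cell `rh-explicit`, seat cc-s2-1 (sub-line (ii), S = {∞, 2}).  Concludes the generic `SoninPolyTrace*` chain.  The six
transcendental inputs (`log 2`, `e^{±b}`, `e^{±2b}`, `e^{±L/2}`; `inputsB`, `inputsB_spec`) are computed once; the loop of
part IV is run in CHUNKS of `w` consecutive indices `k` (each chunk starts from freshly computed running powers
`powState` and zero accumulators), the chunk enclosures are added (`evalChunks`, `evalB`), and the check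
`checkTraceB p b r X prm w c Blo` (engine sanity, `0 ≤ b`, `2 ≤ X`, `|r| = c·w`, `log 2 ≤ 2b` and `2e^{2b} ≤ X` read off
the enclosures, and `Blo·S ≤ lo`) together with the separately decided antiderivative table `antiderivsOK (c·w) κ`
yields
`re_soninTraceForm_polyEta_ge_of_check : antiderivsOK … = true → checkTraceB … = true → (Blo : ℝ) ≤ Re soninTraceForm (twistKernel 2 (G⋆G̃)) (polyEta r X)`
— hypothesis `hB` of the frame entry point `SoninFrameBridge.not_semilocalSoninIneqOn_two_of_polyWitness_frame`.
Definitions: `inputsB`, `powState`, `chunkVal`, `evalChunks`, `evalB`, `checkTraceB` (certificate bookkeeping).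
No facts, no axioms.
-/

set_option linter.dupNamespace false  -- the mandated namespace repeats `RiemannHypothesis`

noncomputable section

open MeasureTheory Set Finset
open scoped Real
open Summit.RiemannHypothesis.RiemannHypothesis.Theorems.SemilocalPolyWitness
open Literature.NumberTheory.LFunctions Literature.NumberTheory.ConnesConsani2021
open Literature.Analysis.ValidatedNumerics Literature.Analysis.ValidatedNumerics.NumericsMP

namespace Summit.RiemannHypothesis.RiemannHypothesis.SoninPoly

variable (b : ℚ) (r : List ℚ) (X : ℚ) (κL : List ℚ)

/-- The transcendental inputs: `Λ ∋ log 2` and `e^{±b}`, `e^{±2b}`, `e^{±L/2}`. [folklore] -/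
def inputsB (prm : EvalParams) : Option (MI × MI × MI × MI × MI × MI × MI) :=
  match MI.logTwo prm.S prm.Kl with
  | none => none
  | some Λ =>
    match MI.exp prm.S prm.Ke prm.ke (ofQ prm.S b), MI.exp prm.S prm.Ke prm.ke (ofQ prm.S (-b)),
      MI.exp prm.S prm.Ke prm.ke (ofQ prm.S (2 * b)), MI.exp prm.S prm.Ke prm.ke (ofQ prm.S (-(2 * b))),
      MI.exp prm.S prm.Ke prm.ke (Λ.divNat 2), MI.exp prm.S prm.Ke prm.ke ((Λ.neg).divNat 2) with
    | some E1, some E1m, some E2, some E2m, some R2, some R2m => some (Λ, E1, E1m, E2, E2m, R2, R2m)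
    | _, _, _, _, _, _ => none


/-- The running powers at index `k`, from the inputs: `powState 0 = ⟨E1, E1m, R2, R2m⟩`, then `step`. [folklore] -/
def powState (S : ℕ) (E1 E1m R2 R2m E2 E2m : MI) : ℕ → ZState
  | 0 => ⟨E1, E1m, R2, R2m⟩
  | k + 1 => (powState S E1 E1m R2 R2m E2 E2m k).step S E2 E2m

/-- One chunk: the loop of part IV run for `w` steps from index `k₀` with fresh powers and zero accumulators;
returns `(aN, aP)`. [folklore] -/
def chunkVal (S : ℕ) (Λ eh E1 E1m R2 R2m E2 E2m : MI) (w k₀ : ℕ) : MI × MI :=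
  loopB b r X κL S Λ eh E2 E2m w k₀ (SPtab κL k₀ w) (SNtab κL k₀ w) (powState S E1 E1m R2 R2m E2 E2m k₀)
    (MI.ofInt S 0) (MI.ofInt S 0)

/-- `c` consecutive chunks of width `w` from `k₀`: the sum of `aN − aP` over the chunks. [folklore] -/
def evalChunks (S : ℕ) (Λ eh E1 E1m R2 R2m E2 E2m : MI) (w : ℕ) : ℕ → ℕ → MI
  | 0, _ => MI.ofInt S 0
  | c + 1, k₀ =>
    let v := chunkVal b r X κL S Λ eh E1 E1m R2 R2m E2 E2m w k₀
    forceMI (v.1.sub v.2) fun d => d.add (evalChunks S Λ eh E1 E1m R2 R2m E2 E2m w c (k₀ + w))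

/-- **Enclosure of `B`** `= Σ_k (WN_k I(−(2k+1)) − WP_k I(2k+1))`, in `c` chunks of width `w`. [folklore] -/
def evalB (prm : EvalParams) (w c : ℕ) : Option MI :=
  match inputsB b prm with
  | none => none
  | some (Λ, E1, E1m, E2, E2m, R2, R2m) => some (evalChunks b r X κL prm.S Λ R2m E1 E1m R2 R2m E2 E2m w c 0)

/-- **THE CHECK**: engine sanity (`0 < S`), `0 ≤ b`, `2 ≤ X`, `|r| = c·w`, the side conditions `log 2 ≤ 2b` and
`2e^{2b} ≤ X` from the enclosures, and `Blo·S ≤ (evalB).lo` (the antiderivative table is checked separately). [folklore] -/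
def checkTraceB (p : List ℚ) (b : ℚ) (r : List ℚ) (X : ℚ) (prm : EvalParams) (w c : ℕ) (Blo : ℚ) : Bool :=
  decide (0 < prm.S) && decide (0 ≤ b) && decide (2 ≤ X) && decide (r.length = c * w) &&
  (match inputsB b prm with
    | some (Λ, _, _, E2, _, _, _) => decide ((Λ.hi : ℚ) ≤ 2 * b * prm.S) && decide (2 * (E2.hi : ℚ) ≤ X * prm.S)
    | none => false) &&
  (match evalB b r X (kappaL p b) prm w c with
    | some V => decide ((Blo : ℚ) * prm.S ≤ V.lo)
    | none => false)

/-! ## Soundness -/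

variable {b r X κL}

/-- **Soundness of `inputsB`**: the seven enclosures contain `log 2`, `e^{b}`, `e^{−b}`, `e^{2b}`, `e^{−2b}`,
`e^{L/2}`, `e^{−L/2}`. [folklore] -/
theorem inputsB_spec {prm : EvalParams} (hS : 0 < prm.S) {Λ E1 E1m E2 E2m R2 R2m : MI}
    (h : inputsB b prm = some (Λ, E1, E1m, E2, E2m, R2, R2m)) :
    MI.mem prm.S (Real.log 2) Λ ∧ MI.mem prm.S (Real.exp b) E1 ∧ MI.mem prm.S (Real.exp (-b)) E1m ∧
      MI.mem prm.S (Real.exp (2 * b)) E2 ∧ MI.mem prm.S (Real.exp (-(2 * b))) E2m ∧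
      MI.mem prm.S (Real.exp (Real.log 2 / 2)) R2 ∧ MI.mem prm.S (Real.exp (-(Real.log 2 / 2))) R2m := by
  unfold inputsB at h
  split at h
  · simp at h
  · rename_i Λ' hΛ'
    split at h
    · rename_i E1' E1m' E2' E2m' R2' R2m' h1 h2 h3 h4 h5 h6
      simp only [Option.some.injEq, Prod.mk.injEq] at h
      obtain ⟨rfl, rfl, rfl, rfl, rfl, rfl, rfl⟩ := h
      have hΛ := MI.mem_logTwo hS hΛ'
      have m1 : MI.mem prm.S ((b : ℚ) : ℝ) (ofQ prm.S b) := mem_ofQ prm.S b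
      have m2 : MI.mem prm.S (-(b : ℝ)) (ofQ prm.S (-b)) := by
        have := mem_ofQ prm.S (-b); push_cast at this; exact this
      have m3 : MI.mem prm.S (2 * (b : ℝ)) (ofQ prm.S (2 * b)) := by
        have := mem_ofQ prm.S (2 * b); push_cast at this; exact this
      have m4 : MI.mem prm.S (-(2 * (b : ℝ))) (ofQ prm.S (-(2 * b))) := by
        have := mem_ofQ prm.S (-(2 * b)); push_cast at this; exact this
      have m5 : MI.mem prm.S (Real.log 2 / 2) (Λ'.divNat 2) := by
        have := MI.mem_divNat hΛ (n := 2) (by norm_num); push_cast at this; exact this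
      have m6 : MI.mem prm.S (-(Real.log 2 / 2)) ((Λ'.neg).divNat 2) := by
        have := MI.mem_divNat (MI.mem_neg hΛ) (n := 2) (by norm_num)
        push_cast at this
        convert this using 1; ring
      exact ⟨hΛ, MI.mem_exp hS h1 m1, MI.mem_exp hS h2 m2, MI.mem_exp hS h3 m3, MI.mem_exp hS h4 m4,
        MI.mem_exp hS h5 m5, MI.mem_exp hS h6 m6⟩
    · simp at h


/-- The running powers satisfy the loop invariant at every index. [folklore] -/
theorem ZInv_powState {S : ℕ} (hS : 0 < S) {E1 E1m R2 R2m E2 E2m : MI} (hE1 : MI.mem S (Real.exp b) E1)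
    (hE1m : MI.mem S (Real.exp (-b)) E1m) (hR2 : MI.mem S (Real.exp (Real.log 2 / 2)) R2)
    (hR2m : MI.mem S (Real.exp (-(Real.log 2 / 2))) R2m) (hE2 : MI.mem S (Real.exp (2 * b)) E2)
    (hE2m : MI.mem S (Real.exp (-(2 * b))) E2m) : ∀ k : ℕ, ZInv S b k (powState S E1 E1m R2 R2m E2 E2m k)
  | 0 => by
      constructor
      · show MI.mem S _ E1
        convert hE1 using 2; push_cast; ring
      · show MI.mem S _ E1m
        convert hE1m using 2; push_cast; ring
      · show MI.mem S _ R2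
        convert hR2 using 2; push_cast; ring
      · show MI.mem S _ R2m
        convert hR2m using 2; push_cast; ring
  | k + 1 => (ZInv_powState hS hE1 hE1m hR2 hR2m hE2 hE2m k).step hS hE2 hE2m

/-- **Soundness of the chunked sum.** [folklore] -/
theorem mem_evalChunks {S : ℕ} (hS : 0 < S) {Λ eh E1 E1m R2 R2m E2 E2m : MI} (hΛ : MI.mem S (Real.log 2) Λ)
    (heh : MI.mem S (Real.exp (-(Real.log 2 / 2))) eh) (hE1 : MI.mem S (Real.exp b) E1)
    (hE1m : MI.mem S (Real.exp (-b)) E1m) (hR2 : MI.mem S (Real.exp (Real.log 2 / 2)) R2)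
    (hR2m : MI.mem S (Real.exp (-(Real.log 2 / 2))) R2m) (hE2 : MI.mem S (Real.exp (2 * b)) E2)
    (hE2m : MI.mem S (Real.exp (-(2 * b))) E2m) (hL : Real.log 2 ≤ 2 * (b : ℝ)) (hQ : antiderivsOK r.length κL = true)
    (w : ℕ) : ∀ (c k₀ : ℕ), k₀ + c * w ≤ r.length →
      MI.mem S (∑ k ∈ Finset.Ico k₀ (k₀ + c * w),
          ((WN r X k : ℝ) * Iint κL b (-(2 * (k : ℤ) + 1)) - (WP r k : ℝ) * Iint κL b (2 * (k : ℤ) + 1)))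
        (evalChunks b r X κL S Λ eh E1 E1m R2 R2m E2 E2m w c k₀)
  | 0, k₀, _ => by
      simp only [evalChunks, Nat.zero_mul, add_zero, Finset.Ico_self, Finset.sum_empty]
      simpa using MI.mem_ofInt S 0
  | c + 1, k₀, hk => by
      have hw : k₀ + w ≤ r.length := by nlinarith
      have m0 : MI.mem S (0 : ℝ) (MI.ofInt S 0) := by simpa using MI.mem_ofInt S 0
      have hchunk := mem_loopB (X := X) hS hΛ heh hE2 hE2m hL hQ w k₀ _ _ _ 0 0 hw
        (ZInv_powState hS hE1 hE1m hR2 hR2m hE2 hE2m k₀) m0 m0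
      simp only [zero_add] at hchunk
      have hd := MI.mem_sub hchunk.1 hchunk.2
      have ih := mem_evalChunks hS hΛ heh hE1 hE1m hR2 hR2m hE2 hE2m hL hQ w c (k₀ + w)
        (by rw [Nat.succ_mul] at hk; omega)
      have htot := MI.mem_add hd ih
      simp only [evalChunks, forceMI_eq]
      convert htot using 1
      rw [← Finset.sum_sub_distrib, show k₀ + (c + 1) * w = (k₀ + w) + c * w by ring,
        ← Finset.sum_Ico_consecutive _ (Nat.le_add_right k₀ w) (Nat.le_add_right (k₀ + w) (c * w))]
      rfl

/-- **Soundness of `evalB`**: `evalB = some V ⇒ B ∈ V` (given the table checks, `|r| = c·w` and the side conditions).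
[folklore] -/
theorem mem_evalB {p : List ℚ} {prm : EvalParams} {w c : ℕ} (hS : 0 < prm.S) (hb : 0 ≤ b) (hX0 : 0 ≤ X)
    (hL : Real.log 2 ≤ 2 * (b : ℝ)) (hX : 2 * Real.exp (2 * b) ≤ X) (hQ : antiderivsOK r.length (kappaL p b) = true)
    (hlen : r.length = c * w) {V : MI} (h : evalB b r X (kappaL p b) prm w c = some V) :
    MI.mem prm.S (soninTraceForm (twistKernel 2 (weilConv (polyWitness p b) (weilReflect (polyWitness p b))))
        (polyEta r hX0 : ℝ → ℂ)).re V := by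
  rw [re_soninTraceForm_eq_weighted_sums r hb hX0 hX]
  unfold evalB at h
  split at h
  · simp at h
  · rename_i Λ E1 E1m E2 E2m R2 R2m hin
    simp only [Option.some.injEq] at h
    subst h
    obtain ⟨hΛ, mE1, mE1m, mE2, mE2m, mR2, mR2m⟩ := inputsB_spec hS hin
    have hl := mem_evalChunks (X := X) (κL := kappaL p b) hS hΛ mR2m mE1 mE1m mR2 mR2m mE2 mE2m hL hQ w c 0
      (by omega)
    simp only [zero_add] at hl
    rw [← hlen, ← Finset.range_eq_Ico, Finset.sum_sub_distrib] at hl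
    exact hl

/-- **THE LOWER BOUND FROM THE CHECK**: `checkTraceB … Blo = true ⇒ Blo ≤ Re ⟨η | ϑ(T₂(G⋆G̃)) η⟩` for
`G = polyWitness p b`, `η = polyEta r X` (any `0 ≤ X`; the check itself certifies `2 ≤ X`, `0 ≤ b`, `log 2 ≤ 2b`,
`2e^{2b} ≤ X`, `|r| = c·w`; the antiderivative table `antiderivsOK` is a separate hypothesis, decided once per `(p, b, n)`). [folklore] -/
theorem re_soninTraceForm_polyEta_ge_of_check {p : List ℚ} {prm : EvalParams} {w c : ℕ} {Blo : ℚ} (hX0 : 0 ≤ X)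
    (hQ : antiderivsOK (c * w) (kappaL p b) = true) (hc : checkTraceB p b r X prm w c Blo = true) :
    ((Blo : ℚ) : ℝ) ≤ (soninTraceForm (twistKernel 2 (weilConv (polyWitness p b) (weilReflect (polyWitness p b))))
        (polyEta r hX0 : ℝ → ℂ)).re := by
  unfold checkTraceB at hc
  simp only [Bool.and_eq_true, decide_eq_true_eq] at hc
  obtain ⟨⟨⟨⟨⟨hS, hb⟩, hX2⟩, hlen⟩, hside⟩, hmain⟩ := hc
  rw [← hlen] at hQ
  have hSr : (0 : ℝ) < prm.S := by exact_mod_cast hS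
  have hsides : Real.log 2 ≤ 2 * (b : ℝ) ∧ 2 * Real.exp (2 * b) ≤ X := by
    split at hside
    · rename_i Λ E1 E1m E2 E2m R2 R2m hin
      simp only [Bool.and_eq_true, decide_eq_true_eq] at hside
      obtain ⟨hΛ, -, -, mE2, -, -, -⟩ := inputsB_spec hS hin
      have h1' := MI.le_hi_div hS hΛ
      have h2' : ((Λ.hi : ℚ) : ℝ) ≤ ((2 * b * prm.S : ℚ) : ℝ) := by exact_mod_cast hside.1
      push_cast at h2'
      rw [le_div_iff₀ hSr] at h1'
      have h3' := MI.le_hi_div hS mE2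
      have h4' : ((2 * (E2.hi : ℚ) : ℚ) : ℝ) ≤ ((X * prm.S : ℚ) : ℝ) := by exact_mod_cast hside.2
      push_cast at h4'
      rw [le_div_iff₀ hSr] at h3'
      constructor <;> nlinarith
    · simp at hside
  split at hmain
  · rename_i V hV
    simp only [decide_eq_true_eq] at hmain
    have hmem := mem_evalB hS hb hX0 hsides.1 hsides.2 hQ hlen hV
    have h1 := MI.lo_div_le hS hmem
    have h2 : ((Blo * prm.S : ℚ) : ℝ) ≤ ((V.lo : ℚ) : ℝ) := by exact_mod_cast hmain
    push_cast at h2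
    rw [div_le_iff₀ hSr] at h1
    nlinarith
  · simp at hmain

end Summit.RiemannHypothesis.RiemannHypothesis.SoninPoly

end
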